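import Mathlib
import Summits.Ventures.YMGap.FlowData.EigenRadiusInvariantBlock

/-!
# Venture YMGap, track Y3 FLOW-DATA — the invariant-block radius fed by a FLOATING-POINT symmetry basis

HONEST FRAMING: venture file of the cell `pub-ymgap` (QuantumFields programme), track Y3, lineage B
("B-kstm"), companion of `FlowData/EigenRadiusInvariantBlock.lean`.  That theorem is stated for the EXACT
symmetry basis `Y` (range `S`-invariant); the program (`kscert.c`, symmetry blocks) certifies its block residual
against the FLOAT basis `Ỹ` it actually holds (`symmetry.py`: `|Ỹ − Y| ≤ 2u|Y|` entrywise), and adds a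
"subspace" term for the difference.  This file types that glue — pure norm algebra for finite matrices — and
the resulting corollary whose hypotheses are the program's quantities for `Ỹ` plus a Frobenius bound on `Ỹ − Y`
and operator bounds `‖S‖ ≤ Λ`, `‖S Y‖ ≤ Λ₁`.  No lattice object, no number, no row; the program's interval
arithmetic is not modelled.

WHAT IS TYPED (`𝕜 = ℝ` or `ℂ`, finite index types, Frobenius bounds as `Σ‖·ᵢⱼ‖² ≤ c²`, operator bounds
unbundled as `∀ v, ‖M v‖ ≤ Λ‖v‖` in `EuclideanSpace`):
* `norm_toEuclideanLin_conjTranspose_le` — `‖Mᴴ‖ ≤ Λ` from `‖M‖ ≤ Λ`;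
* `sum_norm_sq_mul_le` — `‖M E‖_F ≤ ‖M‖₂ ‖E‖_F`; `sum_norm_sq_conjTranspose` — `‖Mᴴ‖_F = ‖M‖_F`;
* `sum_norm_sq_add_le` — Minkowski `‖P + Q‖_F ≤ p + q`;
* `sum_norm_sq_gramS_sub_le` — THE GLUE: `‖Ỹᴴ S Ỹ − Yᴴ S Y‖_F ≤ 2Λ₁η + Λη²` for Hermitian `S` with `‖S‖ ≤ Λ`,
  `‖S Y‖ ≤ Λ₁`, `‖Ỹ − Y‖_F ≤ η`;
* `exists_orthonormal_eigenvectors_of_invariantBlock_float` — `exists_orthonormal_eigenvectors_of_invariantBlock`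
  with the block residual measured against the float basis: `Σ‖(Ỹᴴ S Ỹ − A)ᵢⱼ‖² ≤ E0²` replaces the exact-basis
  hypothesis at the price `E0 ↦ E0 + 2Λ₁η + Λη²` in the radius.

References: G. W. Stewart, J.-G. Sun, *Matrix Perturbation Theory* (1990), Thm VI.1.15 [cite: StewartSun1990,
Thm VI.1.15]; the cell's `pub-ymgap-flow-eng-2/kscert.c` (symmetry blocks) and `flow/flow-eng-2/RADIUS-CHECK.md` §3.
-/

noncomputable section

open Matrix WithLp
open scoped InnerProductSpace

namespace Summit.Ventures.YMGap.FlowData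

namespace EigenRadius

variable {𝕜 : Type*} [RCLike 𝕜]

section Glue

variable {a b c : Type*} [Fintype a] [Fintype b] [Fintype c] [DecidableEq a] [DecidableEq b] [DecidableEq c]

omit [DecidableEq c] [Fintype c] in
/-- The adjoint has the same operator bound: `‖M v‖ ≤ Λ‖v‖` for all `v` implies `‖Mᴴ w‖ ≤ Λ‖w‖`. [folklore] -/
theorem norm_toEuclideanLin_conjTranspose_le (M : Matrix a b 𝕜) {Λ : ℝ} (hΛ : 0 ≤ Λ)
    (hM : ∀ v : EuclideanSpace 𝕜 b, ‖toEuclideanLin M v‖ ≤ Λ * ‖v‖) (w : EuclideanSpace 𝕜 a) :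
    ‖toEuclideanLin Mᴴ w‖ ≤ Λ * ‖w‖ := by
  set u : EuclideanSpace 𝕜 b := toEuclideanLin Mᴴ w with hu
  have h1 : ‖u‖ ^ 2 ≤ Λ * ‖w‖ * ‖u‖ := by
    have e : ‖u‖ ^ 2 = RCLike.re ⟪toEuclideanLin M u, w⟫_𝕜 := by
      rw [norm_sq_eq_re_inner (𝕜 := 𝕜), hu, Matrix.toEuclideanLin_conjTranspose_eq_adjoint,
        LinearMap.adjoint_inner_right]
    rw [e]
    calc RCLike.re ⟪toEuclideanLin M u, w⟫_𝕜 ≤ ‖⟪toEuclideanLin M u, w⟫_𝕜‖ := RCLike.re_le_norm _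
      _ ≤ ‖toEuclideanLin M u‖ * ‖w‖ := norm_inner_le_norm _ _
      _ ≤ Λ * ‖u‖ * ‖w‖ := mul_le_mul_of_nonneg_right (hM u) (norm_nonneg _)
      _ = Λ * ‖w‖ * ‖u‖ := by ring
  by_contra hneg
  have hlt : Λ * ‖w‖ < ‖u‖ := lt_of_not_ge hneg
  have hpos : 0 < ‖u‖ := lt_of_le_of_lt (mul_nonneg hΛ (norm_nonneg _)) hlt
  nlinarith [mul_lt_mul_of_pos_right hlt hpos]

omit [DecidableEq a] [DecidableEq c] in
/-- **Frobenius of a product ≤ operator norm × Frobenius:** `Σᵢⱼ ‖(M E)ᵢⱼ‖² ≤ Λ² Σₖⱼ ‖Eₖⱼ‖²` whenever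
`‖M v‖ ≤ Λ‖v‖` for all `v` (column by column). [folklore] -/
theorem sum_norm_sq_mul_le (M : Matrix a b 𝕜) (E : Matrix b c 𝕜) {Λ : ℝ}
    (hM : ∀ v : EuclideanSpace 𝕜 b, ‖toEuclideanLin M v‖ ≤ Λ * ‖v‖) :
    ∑ i, ∑ j, ‖(M * E) i j‖ ^ 2 ≤ Λ ^ 2 * ∑ k, ∑ j, ‖E k j‖ ^ 2 := by
  have hcol : ∀ j, ∑ i, ‖(M * E) i j‖ ^ 2 ≤ Λ ^ 2 * ∑ k, ‖E k j‖ ^ 2 := fun j => by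
    have h := pow_le_pow_left₀ (norm_nonneg _) (hM (toLp 2 fun k => E k j)) 2
    have e1 : toEuclideanLin M (toLp 2 fun k => E k j) = toLp 2 (M *ᵥ fun k => E k j) := rfl
    rw [e1, mul_pow, EuclideanSpace.norm_sq_eq, EuclideanSpace.norm_sq_eq] at h
    calc ∑ i, ‖(M * E) i j‖ ^ 2 = ∑ i, ‖(M *ᵥ fun k => E k j) i‖ ^ 2 :=
          Finset.sum_congr rfl fun i _ => rfl
      _ ≤ Λ ^ 2 * ∑ k, ‖E k j‖ ^ 2 := h
  calc ∑ i, ∑ j, ‖(M * E) i j‖ ^ 2 = ∑ j, ∑ i, ‖(M * E) i j‖ ^ 2 := Finset.sum_comm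
    _ ≤ ∑ j, Λ ^ 2 * ∑ k, ‖E k j‖ ^ 2 := Finset.sum_le_sum fun j _ => hcol j
    _ = Λ ^ 2 * ∑ k, ∑ j, ‖E k j‖ ^ 2 := by rw [← Finset.mul_sum, Finset.sum_comm]

omit [DecidableEq a] [DecidableEq b] in
/-- The Frobenius sum is invariant under the conjugate transpose. [folklore] -/
theorem sum_norm_sq_conjTranspose (M : Matrix a b 𝕜) :
    ∑ i, ∑ j, ‖Mᴴ i j‖ ^ 2 = ∑ i, ∑ j, ‖M i j‖ ^ 2 := by
  rw [Finset.sum_comm]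
  refine Finset.sum_congr rfl fun i _ => Finset.sum_congr rfl fun j _ => ?_
  rw [conjTranspose_apply, norm_star]

omit [DecidableEq a] [DecidableEq c] in
/-- The Frobenius sum of `P − Q` equals that of `Q − P`. [folklore] -/
theorem sum_norm_sq_sub_comm (P Q : Matrix a c 𝕜) :
    ∑ i, ∑ j, ‖(P - Q) i j‖ ^ 2 = ∑ i, ∑ j, ‖(Q - P) i j‖ ^ 2 := by
  refine Finset.sum_congr rfl fun i _ => Finset.sum_congr rfl fun j _ => ?_
  rw [Matrix.sub_apply, Matrix.sub_apply, norm_sub_rev]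

omit [DecidableEq a] [DecidableEq c] in
/-- **Minkowski in `Σ²` form:** `Σ‖Pᵢⱼ‖² ≤ p²`, `Σ‖Qᵢⱼ‖² ≤ q²` (`p, q ≥ 0`) give `Σ‖(P + Q)ᵢⱼ‖² ≤ (p + q)²`. [folklore] -/
theorem sum_norm_sq_add_le (P Q : Matrix a c 𝕜) {p q : ℝ} (hp : 0 ≤ p) (hq : 0 ≤ q)
    (hP : ∑ i, ∑ j, ‖P i j‖ ^ 2 ≤ p ^ 2) (hQ : ∑ i, ∑ j, ‖Q i j‖ ^ 2 ≤ q ^ 2) :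
    ∑ i, ∑ j, ‖(P + Q) i j‖ ^ 2 ≤ (p + q) ^ 2 := by
  let vec : Matrix a c 𝕜 → EuclideanSpace 𝕜 (a × c) := fun R => toLp 2 fun ij => R ij.1 ij.2
  have hv : ∀ R : Matrix a c 𝕜, ‖vec R‖ ^ 2 = ∑ i, ∑ j, ‖R i j‖ ^ 2 := fun R => by
    rw [EuclideanSpace.norm_sq_eq, Fintype.sum_prod_type]
  have hadd : vec (P + Q) = vec P + vec Q := rfl
  have hPn : ‖vec P‖ ≤ p := (pow_le_pow_iff_left₀ (norm_nonneg _) hp two_ne_zero).1 (by rw [hv]; exact hP)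
  have hQn : ‖vec Q‖ ≤ q := (pow_le_pow_iff_left₀ (norm_nonneg _) hq two_ne_zero).1 (by rw [hv]; exact hQ)
  rw [← hv, hadd]
  exact pow_le_pow_left₀ (norm_nonneg _) ((norm_add_le _ _).trans (add_le_add hPn hQn)) 2

/-- **The glue.** For Hermitian `S` with `‖S v‖ ≤ Λ‖v‖`, an exact basis matrix `Y` with `‖(S Y) v‖ ≤ Λ₁‖v‖`,
and a perturbed (floating-point) `Ỹ` with `Σ‖(Ỹ − Y)ᵢⱼ‖² ≤ η²`:
`Σ‖(Ỹᴴ S Ỹ − Yᴴ S Y)ᵢⱼ‖² ≤ (2Λ₁η + Λη²)²`  (`Ỹᴴ S Ỹ − Yᴴ S Y = (SY)ᴴE + ((SY)ᴴE)ᴴ + (SE)ᴴE`, `E = Ỹ − Y`). [folklore] -/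
theorem sum_norm_sq_gramS_sub_le {S : Matrix a a 𝕜} (hS : S.IsHermitian) (Y Yt : Matrix a b 𝕜)
    {η Λ Λ₁ : ℝ} (hη : 0 ≤ η) (hΛ : 0 ≤ Λ) (hΛ₁ : 0 ≤ Λ₁)
    (hE : ∑ i, ∑ j, ‖(Yt - Y) i j‖ ^ 2 ≤ η ^ 2)
    (hSop : ∀ v : EuclideanSpace 𝕜 a, ‖toEuclideanLin S v‖ ≤ Λ * ‖v‖)
    (hSY : ∀ v : EuclideanSpace 𝕜 b, ‖toEuclideanLin (S * Y) v‖ ≤ Λ₁ * ‖v‖) :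
    ∑ i, ∑ j, ‖(Ytᴴ * S * Yt - Yᴴ * S * Y) i j‖ ^ 2 ≤ (2 * Λ₁ * η + Λ * η ^ 2) ^ 2 := by
  set E : Matrix a b 𝕜 := Yt - Y with hEdef
  have hYt : Yt = Y + E := by rw [hEdef]; abel
  -- the decomposition
  have hdec0 : Ytᴴ * S * Yt - Yᴴ * S * Y = (Yᴴ * S * E + Eᴴ * S * Y) + Eᴴ * S * E := by
    rw [hYt, conjTranspose_add]
    simp only [Matrix.add_mul, Matrix.mul_add]
    abel
  have t1 : Yᴴ * S * E = (S * Y)ᴴ * E := by rw [conjTranspose_mul, hS.eq]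
  have t2 : Eᴴ * S * Y = ((S * Y)ᴴ * E)ᴴ := by
    rw [conjTranspose_mul, conjTranspose_conjTranspose, Matrix.mul_assoc]
  have t3 : Eᴴ * S * E = (S * E)ᴴ * E := by rw [conjTranspose_mul, hS.eq]
  have hdec : Ytᴴ * S * Yt - Yᴴ * S * Y = ((S * Y)ᴴ * E + ((S * Y)ᴴ * E)ᴴ) + (S * E)ᴴ * E := by
    rw [hdec0, t1, t2, t3]
  -- the three bounds
  have hEop : ∀ v : EuclideanSpace 𝕜 b, ‖toEuclideanLin E v‖ ≤ η * ‖v‖ := norm_toEuclideanLin_le' E hη hE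
  have h1 : ∑ i, ∑ j, ‖((S * Y)ᴴ * E) i j‖ ^ 2 ≤ (Λ₁ * η) ^ 2 := by
    refine (sum_norm_sq_mul_le _ _ (norm_toEuclideanLin_conjTranspose_le _ hΛ₁ hSY)).trans ?_
    rw [mul_pow]
    exact mul_le_mul_of_nonneg_left hE (sq_nonneg _)
  have h2 : ∑ i, ∑ j, ‖((S * Y)ᴴ * E)ᴴ i j‖ ^ 2 ≤ (Λ₁ * η) ^ 2 := by
    rw [sum_norm_sq_conjTranspose]; exact h1
  have hSE : ∀ v : EuclideanSpace 𝕜 b, ‖toEuclideanLin (S * E) v‖ ≤ Λ * η * ‖v‖ := fun v => by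
    have e : toEuclideanLin (S * E) v = toEuclideanLin S (toEuclideanLin E v) := by
      change toLp 2 ((S * E) *ᵥ ofLp v) = toLp 2 (S *ᵥ ofLp (toLp 2 (E *ᵥ ofLp v)))
      rw [ofLp_toLp, mulVec_mulVec]
    rw [e, mul_assoc]
    exact (hSop _).trans (mul_le_mul_of_nonneg_left (hEop v) hΛ)
  have h3 : ∑ i, ∑ j, ‖((S * E)ᴴ * E) i j‖ ^ 2 ≤ (Λ * η * η) ^ 2 := by
    refine (sum_norm_sq_mul_le _ _
      (norm_toEuclideanLin_conjTranspose_le _ (mul_nonneg hΛ hη) hSE)).trans ?_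
    rw [mul_pow (Λ * η) η]
    exact mul_le_mul_of_nonneg_left hE (sq_nonneg _)
  rw [hdec]
  have h12 := sum_norm_sq_add_le _ _ (mul_nonneg hΛ₁ hη) (mul_nonneg hΛ₁ hη) h1 h2
  have h123 := sum_norm_sq_add_le _ _ (by positivity) (by positivity) h12 h3
  calc ∑ i, ∑ j, ‖(((S * Y)ᴴ * E + ((S * Y)ᴴ * E)ᴴ) + (S * E)ᴴ * E) i j‖ ^ 2
      ≤ (Λ₁ * η + Λ₁ * η + Λ * η * η) ^ 2 := h123
    _ = (2 * Λ₁ * η + Λ * η ^ 2) ^ 2 := by ring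

end Glue

/-! ### The corollary for the floating-point basis -/

variable {N m : Type*} [Fintype N] [DecidableEq N] [Fintype m] [DecidableEq m]

/-- **Invariant-block radius from the program's float-basis residual.** As
`exists_orthonormal_eigenvectors_of_invariantBlock`, but the block residual is measured against the FLOAT basis
`Ỹ`: `Σ‖(Ỹᴴ S Ỹ − A)ᵢⱼ‖² ≤ E0²`, together with `Σ‖(Ỹ − Y)ᵢⱼ‖² ≤ η²`, `‖S v‖ ≤ Λ‖v‖`, `‖(S Y) v‖ ≤ Λ₁‖v‖`.
Conclusion: orthonormal eigenvectors of `S` in the range of the EXACT basis `Y` (`S Y = Y C`,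
`Σ‖(YᴴY − 1)ᵢⱼ‖² ≤ ε_G²`), `λ₀ ≥ ⋯ ≥ λ_{m−1}`, with
`|λᵢ − λ↓ᵢ(diag L)| ≤ (E1 + √(1+ε)·((E0 + (2Λ₁η + Λη²)) + ε_G·Lmax)) / ((1 − ε_G)√(1 − ε))`.
[cite: StewartSun1990, Thm VI.1.15] -/
theorem exists_orthonormal_eigenvectors_of_invariantBlock_float {S : Matrix N N 𝕜} (hS : S.IsHermitian)
    (Y Yt : Matrix N m 𝕜) {C : Matrix m m 𝕜} (hSY : S * Y = Y * C) (A X : Matrix m m 𝕜) (L : m → ℝ)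
    {E0 E1 ε εG Lmax η Λ Λ₁ : ℝ} (hE0 : 0 ≤ E0) (hE1 : 0 ≤ E1) (hε0 : 0 ≤ ε) (hε1 : ε < 1)
    (hεG0 : 0 ≤ εG) (hεG1 : εG < 1) (hLmax : 0 ≤ Lmax) (hL : ∀ j, |L j| ≤ Lmax)
    (hη : 0 ≤ η) (hΛ : 0 ≤ Λ) (hΛ₁ : 0 ≤ Λ₁)
    (hG : ∑ i, ∑ j, ‖(Yᴴ * Y - 1 : Matrix m m 𝕜) i j‖ ^ 2 ≤ εG ^ 2)
    (hE : ∑ i, ∑ j, ‖(Yt - Y) i j‖ ^ 2 ≤ η ^ 2)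
    (hSop : ∀ v : EuclideanSpace 𝕜 N, ‖toEuclideanLin S v‖ ≤ Λ * ‖v‖)
    (hSYop : ∀ v : EuclideanSpace 𝕜 m, ‖toEuclideanLin (S * Y) v‖ ≤ Λ₁ * ‖v‖)
    (h0 : ∑ i, ∑ j, ‖(Ytᴴ * S * Yt - A) i j‖ ^ 2 ≤ E0 ^ 2)
    (h1 : ∑ i, ∑ j, ‖(A * X - X * diagonal (fun j => ((L j : ℝ) : 𝕜))) i j‖ ^ 2 ≤ E1 ^ 2)
    (hX : ∑ i, ∑ j, ‖(Xᴴ * X - 1) i j‖ ^ 2 ≤ ε ^ 2) :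
    ∃ (lam : Fin (Fintype.card m) → ℝ) (w : Fin (Fintype.card m) → EuclideanSpace 𝕜 N),
      Antitone lam ∧ Orthonormal 𝕜 w ∧
      (∀ i, ∃ c : EuclideanSpace 𝕜 m, w i = toEuclideanLin Y c) ∧
      (∀ i, toEuclideanLin S (w i) = (lam i : 𝕜) • w i) ∧
      ∀ i, |lam i - (isHermitian_diagonal_ofReal (𝕜 := 𝕜) L).eigenvalues₀ i| ≤
        (E1 + √(1 + ε) * ((E0 + (2 * Λ₁ * η + Λ * η ^ 2)) + εG * Lmax)) / ((1 - εG) * √(1 - ε)) := by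
  have hglue := sum_norm_sq_gramS_sub_le hS Y Yt hη hΛ hΛ₁ hE hSop hSYop
  have h0' : ∑ i, ∑ j, ‖(Yᴴ * S * Y - A) i j‖ ^ 2 ≤ (E0 + (2 * Λ₁ * η + Λ * η ^ 2)) ^ 2 := by
    have e : Yᴴ * S * Y - A = (Ytᴴ * S * Yt - A) + (Yᴴ * S * Y - Ytᴴ * S * Yt) := by abel
    rw [e]
    refine sum_norm_sq_add_le _ _ hE0 (by positivity) h0 ?_
    rw [sum_norm_sq_sub_comm]
    exact hglue
  exact exists_orthonormal_eigenvectors_of_invariantBlock hS Y hSY A X L (by positivity) hE1 hε0 hε1 hεG0 hεG1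
    hLmax hL hG h0' h1 hX

end EigenRadius

end Summit.Ventures.YMGap.FlowData
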